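import Literature.Computability.AlgebraicComplexity.MS21MultilinearHasseLemmas
import HarnessLib

/-!
# Explicit polarisation of the second Hasse derivative of a multilinear polynomial, and the chain
# rule through `y ↦ My` (B36 toolkit, stage S2a; cell `val-lit`, seat t18 g5)

Theorem-only file on `MS21MultilinearHasseLemmas.lean` / `MS21DiagonalTensorHasseSeparation.lean`.
Blueprint `HOME/np/t18g5-MS21-thm35-B36-hasse-blueprint.md` (characteristic-free repair of
[MediniShpilka2021, Lemma 5.13 (arXiv:2102.05632 p0029:L3-L26)], registry item B36): the "read-off
layer" of the ANF structure lemma. For a MULTILINEAR `Q` (e.g. `ANF_Δ`, Obs 5.2):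

* `MS2021.hasseD_two_eq_sum_lt_of_multilinear` — the EXPLICIT polarisation
  `Δ²_v Q = Σ_a Σ_{b<a} v_a v_b ∂_a∂_b Q` (no factor `½`, every characteristic; the pure terms
  `v_a² Δ²_{e_a} Q` vanish because `Q` is multilinear);
* `MS2021.hasseD_two_affSubst_refl_eq` — for `P = Q ∘ M` (x5 g3's presentation
  `affSubst le_rfl M 0 Q`) and any direction `u`: `Δ²_u P = (Σ_a Σ_{b<a} (Mu)_a (Mu)_b ∂_a∂_b Q) ∘ M`;
  with `u = c·e_k` this reads the column `k` of `M`: `(Mu)_a = c·M_{a,k}` — these coefficients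
  `M_{ak} M_{bk}` (and, polarising `u = e_k + e_l`, `M_{ak}M_{bl} + M_{al}M_{bk}`) are the entries the
  structure lemma reads off (blueprint (α)–(δ)).

No definitions, no facts (D-0026). HONEST FRAMING: toolkit towards a characteristic-free proof of a
2021 published lemma; `VP ≠ VNP` is NOT proved and nothing here bears on it.

## References
* [MediniShpilka2021] D. Medini, A. Shpilka, CCC 2021 (LIPIcs 200:19) = arXiv:2102.05632: Lemma 5.13
  p0029:L3-L26, Obs 5.2 p0025, Def 3.6 p0017:L44-L49, Lemma 3.8 p0017:L61-L68.
-/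

noncomputable section

open MvPolynomial

namespace Literature.Computability.AlgebraicComplexity

namespace MS2021

section Polarisation

variable {K : Type*} [CommRing K] {σ : Type*} [LinearOrder σ] [Fintype σ]

/-- **Explicit polarisation for multilinear polynomials**: `Δ²_v Q = Σ_a Σ_{b<a} v_a v_b ∂_a ∂_b Q`
(every characteristic; the diagonal terms vanish as `Q` is multilinear, Obs 5.2).
[cite: MediniShpilka2021, Lemma 5.13 (arXiv p0029:L12-L14), Obs 5.2 (p0025), Def 3.6 (p0017:L44-L49)] -/
theorem hasseD_two_eq_sum_lt_of_multilinear (Q : MvPolynomial σ K) (hQ : ∀ i, Q.degreeOf i ≤ 1)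
    (v : σ → K) :
    hasseD 2 v Q = ∑ a, ∑ b ∈ Finset.univ.filter (· < a), C (v a * v b) * pderiv a (pderiv b Q) := by
  classical
  have key : ∀ s : Finset σ, hasseD 2 (∑ i ∈ s, Pi.single i (v i)) Q =
      ∑ a ∈ s, ∑ b ∈ s.filter (· < a), C (v a * v b) * pderiv a (pderiv b Q) := by
    intro s
    induction s using Finset.induction_on_max with
    | empty => rw [Finset.sum_empty, hasseD_dir_zero 2 two_ne_zero, Finset.sum_empty]
    | insert a s ha ih =>
      have has : a ∉ s := fun h => lt_irrefl a (ha a h)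
      rw [Finset.sum_insert has, hasseD_two_add, ih,
        hasseD_single_eq_zero_of_degreeOf_lt 2 a (v a) Q (Nat.lt_succ_of_le (hQ a)), zero_add,
        Finset.sum_insert has]
      -- the new outer index `a`: its inner sum is over all of `s`
      have hfa : (insert a s).filter (· < a) = s := by
        ext b
        simp only [Finset.mem_filter, Finset.mem_insert]
        constructor
        · rintro ⟨hb | hb, hlt⟩
          · exact absurd (hb ▸ hlt) (lt_irrefl _)
          · exact hb
        · exact fun hb => ⟨Or.inr hb, ha b hb⟩
      -- the old outer indices keep their inner sums
      have hfb : ∀ a' ∈ s, (insert a s).filter (· < a') = s.filter (· < a') := by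
        intro a' ha' 
        ext b
        simp only [Finset.mem_filter, Finset.mem_insert]
        constructor
        · rintro ⟨hb | hb, hlt⟩
          · exact absurd ((hb ▸ hlt).trans (ha a' ha')) (lt_irrefl _)
          · exact ⟨hb, hlt⟩
        · exact fun ⟨hb, hlt⟩ => ⟨Or.inr hb, hlt⟩
      have hold : ∑ a' ∈ s, ∑ b ∈ (insert a s).filter (· < a'), C (v a' * v b) * pderiv a' (pderiv b Q) =
          ∑ a' ∈ s, ∑ b ∈ s.filter (· < a'), C (v a' * v b) * pderiv a' (pderiv b Q) :=
        Finset.sum_congr rfl fun a' ha' => by rw [hfb a' ha']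
      rw [hfa, hold, add_comm]
      congr 1
      -- the cross term of the polarisation identity is the new inner sum
      have hsv : ∀ b, (∑ x ∈ s, (Pi.single x (v x) : σ → K)) b = if b ∈ s then v b else 0 := by
        intro b
        rw [Finset.sum_apply]
        split_ifs with hb
        · rw [Finset.sum_eq_single b (fun i _ hne => Pi.single_eq_of_ne (Ne.symm hne) _)
            (fun h => absurd hb h), Pi.single_eq_same]
        · exact Finset.sum_eq_zero fun i hi => Pi.single_eq_of_ne (fun h : b = i => hb (h ▸ hi)) _
      rw [Finset.sum_eq_single a (fun a' _ hne => Finset.sum_eq_zero fun b _ => by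
          rw [Pi.single_eq_of_ne hne, zero_mul, C_0, zero_mul])
        (fun h => absurd (Finset.mem_univ a) h), Pi.single_eq_same,
        ← Finset.sum_subset (Finset.subset_univ s) (fun b _ hb => by
          rw [hsv, if_neg hb, mul_zero, C_0, zero_mul])]
      refine Finset.sum_congr rfl fun b hb => ?_
      rw [hsv, if_pos hb]
  have := key Finset.univ
  rwa [Finset.univ_sum_single] at this

end Polarisation

section LinSubst

variable {K : Type*} [Field K] {N : ℕ}

/-- **Chain rule through `y ↦ My` for the second Hasse derivative of a multilinear `Q`**
(`P = Q(My) = affSubst le_rfl M 0 Q`): `Δ²_u P = (Σ_a Σ_{b<a} (Mu)_a (Mu)_b ∂_a ∂_b Q)(My)`.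
With `u = c·e_k` the coefficients are `c² M_{a,k} M_{b,k}`; with `u = e_k + e_l` they polarise to
`M_{ak}M_{bl} + M_{al}M_{bk}` plus the two pure parts — the entries read off by the structure lemma.
[cite: MediniShpilka2021, Lemma 3.8 (arXiv p0017:L61-L68) and Lemma 5.13 (p0029:L3-L14)] -/
theorem hasseD_two_affSubst_refl_eq (Q : MvPolynomial (Fin N) K) (hQ : ∀ i, Q.degreeOf i ≤ 1)
    (M : Matrix (Fin N) (Fin N) K) (u : Fin N → K) :
    hasseD 2 u (affSubst le_rfl M 0 Q) =
      affSubst le_rfl M 0 (∑ a, ∑ b ∈ Finset.univ.filter (· < a),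
        C ((M.mulVec u) a * (M.mulVec u) b) * pderiv a (pderiv b Q)) := by
  unfold affSubst
  rw [hasseD_aeval_affine _ (fun i j => M (Fin.castLE le_rfl i) j) (fun i => (0 : Fin N → K) (Fin.castLE le_rfl i))
    (fun i => rfl) 2 u Q, hasseD_two_eq_sum_lt_of_multilinear Q hQ]
  rfl

/-- Coordinate instance: along `c·e_k`, `Δ²_{c e_k} (Q(My)) = (Σ_a Σ_{b<a} c² M_{ak} M_{bk} ∂_a∂_b Q)(My)`.
[cite: MediniShpilka2021, Lemma 3.8 (arXiv p0017:L61-L68) and Lemma 5.13 (p0029:L3-L14)] -/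
theorem hasseD_two_single_affSubst_refl_eq (Q : MvPolynomial (Fin N) K) (hQ : ∀ i, Q.degreeOf i ≤ 1)
    (M : Matrix (Fin N) (Fin N) K) (k : Fin N) (c : K) :
    hasseD 2 (Pi.single k c) (affSubst le_rfl M 0 Q) =
      affSubst le_rfl M 0 (∑ a, ∑ b ∈ Finset.univ.filter (· < a),
        C (M a k * c * (M b k * c)) * pderiv a (pderiv b Q)) := by
  have hmv : ∀ a, M.mulVec (Pi.single k c) a = M a k * c := fun a => dotProduct_single _ _ _
  rw [hasseD_two_affSubst_refl_eq Q hQ]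
  simp_rw [hmv]

end LinSubst

end MS2021

end Literature.Computability.AlgebraicComplexity
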